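import Summits.BirchSwinnertonDyer.BirchSwinnertonDyer.Theorems.ResidualThetaTransportAtTwoThetaLayerLambdaCongruenceAtTwoOfBz
import Literature.NumberTheory.EllipticCurves.ModularJacobianMultiplicityOneOfEichlerShimura
import HarnessLib

/-!
# Kan⁺ `ThetaLayerLambdaCongruenceAtTwo` from the Eichler–Shimura fact and the `J₁(N)` input

Companion of `…ThetaLayerLambdaCongruenceAtTwoOfGaloisData.lean`: the same composition with the Galois datum now
SUPPLIED by the cited named fact `nonempty_modularJacobianGaloisData_eichlerShimura`
(`Literature/NumberTheory/EllipticCurves/ModularJacobianMultiplicityOneOfEichlerShimura.lean`: Darmon–Diamond–Taylor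
Thm. 1.29 in Galois form on the tree's `ModularJacobianGaloisData` interface), so that the crux
`stmt-BirchSwinnertonDyer-20688` is displayed CONDITIONAL on exactly: (1) that standard fact, and (2) the `J₁(N)` input
`hJ₁` of Buzzard's proof of Prop. 2.4 — for the `𝕋/𝔪`-linear Galois representation `σ` on `J0 N[𝔪]`, a `σ`-stable
subspace with commuting action and codimension `≤ 2` (Buzzard 2000 Lemma 2.3 ⟸ Ling–Oesterlé; appendix to Ribet–Stein
Thm. 6.1, `dim J₁(N)[𝔪] = 2`). Kernel road: `thetaLayerLambdaCongruenceAtTwo_of_bz` ∘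
`buzzard2000_multiplicityOne_gamma0_of_eichlerShimura`.

HONESTY: CONDITIONAL — Kan⁺ is NOT settled by this file and BSD is not proved by any of this.
-/

set_option autoImplicit false

noncomputable section

-- justification: the `Summit.BirchSwinnertonDyer.BirchSwinnertonDyer.…` path repeats a component (route-file convention)
set_option linter.dupNamespace false

open scoped MatrixGroups NumberField ModularForm
open CongruenceSubgroup IsDedekindDomain Rat.HeightOneSpectrum Polynomial
open Literature.NumberTheory.EllipticCurves.ModularForms Literature.NumberTheory.GaloisRepresentations
open Summit.BirchSwinnertonDyer.BirchSwinnertonDyer.Theses.ResidualThetaTransportAtTwo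

namespace Summit.BirchSwinnertonDyer.BirchSwinnertonDyer.Theorems.ThetaLayerLambdaCongruenceAtTwo

/-- **Kan⁺ `ThetaLayerLambdaCongruenceAtTwo` BY NAME from the Eichler–Shimura fact and the `J₁(N)` input** —
`thetaLayerLambdaCongruenceAtTwo_of_bz` composed with `buzzard2000_multiplicityOne_gamma0_of_eichlerShimura`.
Hypotheses: the named fact `nonempty_modularJacobianGaloisData_eichlerShimura` (Darmon–Diamond–Taylor Thm. 1.29,
Galois form) and `hJ₁` (for every instance of Buzzard's binders, every Galois datum with Eichler–Shimura on `J₀(N)[2]`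
above `p ∤ 2N` and the representation `σ` on `J0 N[𝔪]` agreeing with it: a `σ`-stable `𝕋/𝔪`-subspace with commuting
action and `dim (J0 N[𝔪] ⧸ U) ≤ 2`). CONDITIONAL; Kan⁺ is NOT settled and BSD is not proved by this.
[cite: Buzzard2000LevelLoweringModTwo, Lemma 2.3 and proof of Prop. 2.4 (p. 101)]
[cite: DarmonDiamondTaylor1995, Thm. 1.29 (p. 37) and §4.5 (p. 135)] -/
theorem thetaLayerLambdaCongruenceAtTwo_of_eichlerShimura
    (hES : nonempty_modularJacobianGaloisData_eichlerShimura)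
    (hJ₁ : ∀ (N : ℕ) [NeZero N], Odd N →
      ∀ (𝔪 : Ideal (HeckeRing0 N 2)), 𝔪.IsMaximal → (2 : HeckeRing0 N 2) ∈ 𝔪 →
      ∀ (k : Type) [Field k] [IsAlgClosed k] [TopologicalSpace k] [DiscreteTopology k]
        (ι : HeckeRing0 N 2 ⧸ 𝔪 →+* k) (ρ : ModPGaloisRep ℚ k 2),
        (∀ v : HeightOneSpectrum (𝓞 ℚ), ¬ ((primesEquiv v : Nat.Primes) : ℕ) ∣ 2 * N →
          ρ.IsUnramifiedAt v ∧
            ρ.HasFrobCharpolyAt v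
              (X ^ 2
                - C (ι (Ideal.Quotient.mk 𝔪 (HeckeRing0.T N 2
                    ((primesEquiv v : Nat.Primes) : ℕ) (primesEquiv v : Nat.Primes).2))) * X
                + C (((primesEquiv v : Nat.Primes) : ℕ) : k))) →
        FramedRep.IsIrreducible ρ →
        (∀ v : HeightOneSpectrum (𝓞 ℚ), ((primesEquiv v : Nat.Primes) : ℕ) = 2 →
          ∀ 𝔓 ∈ v.primesAbove, ∃ σ ∈ 𝔓.decompositionSubgroup (Field.absoluteGaloisGroup ℚ),
            ∀ c : k, ((ρ σ : GL (Fin 2) k) : Matrix (Fin 2) (Fin 2) k) ≠ Matrix.scalar (Fin 2) c) →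
        ∀ (ιℂ : AlgebraicClosure ℚ →+* ℂ) (D : ModularJacobianGaloisData N ιℂ),
          (∀ v : HeightOneSpectrum (𝓞 ℚ), ¬ ((primesEquiv v : Nat.Primes) : ℕ) ∣ 2 * N →
            ∀ 𝔓 ∈ v.primesAbove, ∀ φ : Field.absoluteGaloisGroup ℚ, IsArithFrobAt (𝓞 ℚ) φ 𝔓 →
            ∀ x : J0.tors N, (2 : HeckeRing0 N 2) • x = 0 →
              D.galAct φ (D.galAct φ x)
                - (HeckeRing0.T N 2 ((primesEquiv v : Nat.Primes) : ℕ)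
                    (primesEquiv v : Nat.Primes).2) • D.galAct φ x
                + (((primesEquiv v : Nat.Primes) : ℕ) : HeckeRing0 N 2) • x = 0) →
          ∀ σ : Representation (HeckeRing0 N 2 ⧸ 𝔪) (Field.absoluteGaloisGroup ℚ)
              (Submodule.torsionBySet (HeckeRing0 N 2) (J0 N) 𝔪),
            (∀ (g : Field.absoluteGaloisGroup ℚ)
                (x : Submodule.torsionBySet (HeckeRing0 N 2) (J0 N) 𝔪) (x' : J0.tors N),
                (x' : J0 N) = x →
                ((σ g x : Submodule.torsionBySet (HeckeRing0 N 2) (J0 N) 𝔪) : J0 N)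
                  = ((D.galAct g x' : J0.tors N) : J0 N)) →
            ∃ U : Submodule (HeckeRing0 N 2 ⧸ 𝔪) (Submodule.torsionBySet (HeckeRing0 N 2) (J0 N) 𝔪),
              (∀ (g : Field.absoluteGaloisGroup ℚ), ∀ x ∈ U, σ g x ∈ U) ∧
              (∀ (g h : Field.absoluteGaloisGroup ℚ), ∀ x ∈ U, σ g (σ h x) = σ h (σ g x)) ∧
              Module.finrank (HeckeRing0 N 2 ⧸ 𝔪)
                (Submodule.torsionBySet (HeckeRing0 N 2) (J0 N) 𝔪 ⧸ U) ≤ 2) :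
    ThetaLayerLambdaCongruenceAtTwo :=
  thetaLayerLambdaCongruenceAtTwo_of_bz (buzzard2000_multiplicityOne_gamma0_of_eichlerShimura hES hJ₁)

end Summit.BirchSwinnertonDyer.BirchSwinnertonDyer.Theorems.ThetaLayerLambdaCongruenceAtTwo

end
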